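import Mathlib.FieldTheory.KummerPolynomial
import Mathlib.FieldTheory.Minpoly.Field
import Mathlib.RingTheory.Localization.AtPrime.Basic
import Mathlib.RingTheory.Localization.Ideal
import Mathlib.RingTheory.Localization.FractionRing
import Mathlib.RingTheory.Polynomial.Basic
import Mathlib.RingTheory.Ideal.Quotient.Operations
import HarnessLib

/-!
# SUPPORT statement `TopLocusPrimesAreGraphs` of the idea card `planar-shadow-descent` of `res-L1-w45b-idea-1` (crux
# `EquisingularLift`, honest variant EL♮ = `EquisingularLiftNat`, stmt-ResolutionOfSingularities-20038): the GRAPH LEMMA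

[OURS · L W4.5 (b)] Helper for `res-L1-w45b-idea-1`'s Sketch `HOME/L/res-L1-w45b-idea-1/Sketch-L1-idea-1.lean` (v5, §3 «First
lemmas of the cards», card `planar-shadow-descent`): the `Prop` `TopLocusPrimesAreGraphs`, typed there as `def … : Prop`
without proof («TRUE for every char-`p` domain», res-L1-w45b-tri-1 TRIAGE v2.1). NOT a statement of the manuscript under review
(Hironaka 2017); nothing here is attributed to its author. The theorem's TYPE is the Sketch def body VERBATIM; no `def` is
introduced.

**Statement (GRAPH LEMMA).** `A` a domain of characteristic `p`, `g ∈ A`, `𝔭` a prime of `A[X]` containing the purely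
inseparable equation `F = X^p + g` and at which `F` has order `≥ 2` (`F ∈ 𝔭² A[X]_𝔭`). Then `𝔭 ∋ b·X − a` for some
`a, b ∈ A` with `b ∉ 𝔭`: generically the centre `V(𝔭)` is the GRAPH `X = a/b` over its shadow `V(𝔭 ∩ A)`.

**Proof.** Let `𝔮 = 𝔭 ∩ A`, `K = Frac(A/𝔮)`, `L = Frac(A[X]/𝔭) ⊇ K`, `x̄ ∈ L` the class of `X`, `h = minpoly_K(x̄)` (so that
`𝔭·K[X] ⊆ (h)` and `s ∉ 𝔭 ⇒ h ∤ s̄`). Order `≥ 2` gives `s ∉ 𝔭` with `sF ∈ 𝔭²`, hence `h² ∣ s̄·F̄` in `K[X]` and `h² ∣ F̄ =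
X^p + ḡ`. Kummer's criterion (`X_pow_sub_C_irreducible_iff_of_prime`): if `−ḡ` is not a `p`-th power in `K` then `F̄` is
irreducible, so `h ~ F̄` and `h² ∣ h` — impossible; hence `−ḡ = c^p`, `F̄ = (X − c)^p`, `h ∣ X − c`, i.e. `x̄ = c = ā/b̄ ∈ K`
with `b ∉ 𝔮`, and `bX − a ∈ 𝔭`.

AI-written; AI review is weaker than expert review.
-/

set_option linter.dupNamespace false

noncomputable section

namespace Summit.ResolutionOfSingularities.ResolutionOfSingularities.Theorems.EquisingularLift.PlanarShadow

open IsLocalRing Polynomial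

/-- **§3 GRAPH LEMMA (Sketch `TopLocusPrimesAreGraphs`, body VERBATIM; card `planar-shadow-descent`, first lemma).** For the
purely inseparable hypersurface `X^p + g`, `g ∈ A` (`A` a domain of characteristic `p`), every prime `𝔭` of `A[X]` at which
`X^p + g` has order `≥ 2` contains an element `b·X − a` with `b ∉ 𝔭`: the centre `V(𝔭)` is, generically, the GRAPH `X = a/b`
over its shadow `V(𝔭 ∩ A)`. (Over `K = Frac(A/𝔭 ∩ A)`: if `ḡ` is not a `p`-th power then `X^p + ḡ` is irreducible and of order
one at `𝔭`; otherwise `X^p + ḡ = (X − c)^p` and the minimal polynomial of `X̄` is `X − c`.) OURS; idea card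
`planar-shadow-descent` of res-L1-w45b-idea-1 (L W4.5 (b), EL♮ stmt-ResolutionOfSingularities-20038); not a statement of the
manuscript under review. -/
theorem topLocusPrimesAreGraphs :
    ∀ (A : Type) [CommRing A] [IsDomain A] (p : ℕ) [Fact p.Prime] [CharP A p] (g : A)
      (𝔭 : Ideal (Polynomial A)) [𝔭.IsPrime],
      (X ^ p + C g : Polynomial A) ∈ 𝔭 →
      algebraMap (Polynomial A) (Localization.AtPrime 𝔭) (X ^ p + C g)
          ∈ (maximalIdeal (Localization.AtPrime 𝔭)) ^ 2 →
        ∃ a b : A, C b ∉ 𝔭 ∧ C b * X - C a ∈ 𝔭 := by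
  intro A _ _ p _ _ g 𝔭 _ hF hF2
  classical
  have hp : p.Prime := Fact.out
  -- Step 0: order ≥ 2 ⇒ `s F ∈ 𝔭²` for some `s ∉ 𝔭`
  rw [← Localization.AtPrime.map_eq_maximalIdeal, ← Ideal.map_pow,
    IsLocalization.algebraMap_mem_map_algebraMap_iff 𝔭.primeCompl] at hF2
  obtain ⟨s, hs, hsF⟩ := hF2
  have hs' : s ∉ 𝔭 := hs
  -- Step 1: the shadow prime `𝔮 = 𝔭 ∩ A`, `K = Frac(A/𝔮)`, `L = Frac(A[X]/𝔭)`
  set 𝔮 : Ideal A := 𝔭.comap (C : A →+* A[X]) with h𝔮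
  haveI : 𝔮.IsPrime := Ideal.IsPrime.comap C
  haveI : IsDomain (A ⧸ 𝔮) := Ideal.Quotient.isDomain 𝔮
  haveI : IsDomain (A[X] ⧸ 𝔭) := Ideal.Quotient.isDomain 𝔭
  set B := A ⧸ 𝔮 with hB
  set K := FractionRing B with hK
  set D := A[X] ⧸ 𝔭 with hD
  set L := FractionRing D with hL
  -- `jA : A → L` kills `𝔮`; the induced `jB : B → L` is injective and extends to `i : K → L`
  let jA : A →+* L := (algebraMap D L).comp ((Ideal.Quotient.mk 𝔭).comp (C : A →+* A[X]))
  have hjA : ∀ a : A, a ∈ 𝔮 → jA a = 0 := by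
    intro a ha
    change algebraMap D L (Ideal.Quotient.mk 𝔭 (C a)) = 0
    rw [Ideal.Quotient.eq_zero_iff_mem.mpr (by simpa [h𝔮] using ha), map_zero]
  let jB : B →+* L := Ideal.Quotient.lift 𝔮 jA hjA
  have hjB : Function.Injective jB := by
    rw [injective_iff_map_eq_zero]
    intro b hb
    obtain ⟨a, rfl⟩ := Ideal.Quotient.mk_surjective b
    rw [Ideal.Quotient.lift_mk] at hb
    change algebraMap D L (Ideal.Quotient.mk 𝔭 (C a)) = 0 at hb
    rw [map_eq_zero_iff _ (IsFractionRing.injective D L), Ideal.Quotient.eq_zero_iff_mem] at hb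
    exact Ideal.Quotient.eq_zero_iff_mem.mpr (by simpa [h𝔮] using hb)
  let i : K →+* L := IsFractionRing.lift hjB
  letI : Algebra K L := i.toAlgebra
  have hi : ∀ b : B, algebraMap K L (algebraMap B K b) = jB b := fun b =>
    IsFractionRing.lift_algebraMap hjB b
  have hja : ∀ a : A, algebraMap D L (Ideal.Quotient.mk 𝔭 (C a)) =
      algebraMap K L (algebraMap B K (Ideal.Quotient.mk 𝔮 a)) := by
    intro a
    rw [hi, Ideal.Quotient.lift_mk]
    rfl
  -- the class `x̄` of `X` and the reduction map `φ : A[X] → K[X]`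
  set x : L := algebraMap D L (Ideal.Quotient.mk 𝔭 X) with hx
  let φ : A[X] →+* K[X] := Polynomial.mapRingHom ((algebraMap B K).comp (Ideal.Quotient.mk 𝔮))
  have hcomp : ∀ f : A[X], Polynomial.aeval x (φ f) = algebraMap D L (Ideal.Quotient.mk 𝔭 f) := by
    intro f
    have key : ((Polynomial.aeval x).toRingHom.comp φ) =
        (algebraMap D L).comp (Ideal.Quotient.mk 𝔭) := by
      apply Polynomial.ringHom_ext
      · intro a
        change Polynomial.aeval x (Polynomial.map _ (C a)) = algebraMap D L (Ideal.Quotient.mk 𝔭 (C a))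
        rw [Polynomial.map_C, Polynomial.aeval_C, RingHom.comp_apply, hi, Ideal.Quotient.lift_mk]
        rfl
      · change Polynomial.aeval x (Polynomial.map _ X) = algebraMap D L (Ideal.Quotient.mk 𝔭 X)
        rw [Polynomial.map_X, Polynomial.aeval_X]
    exact congrArg (fun ψ : A[X] →+* L => ψ f) key
  -- consequences: `φ 𝔭` annihilates `x̄`; `φ s` does not
  have hzero : ∀ f ∈ 𝔭, Polynomial.aeval x (φ f) = 0 := by
    intro f hf
    rw [hcomp, Ideal.Quotient.eq_zero_iff_mem.mpr hf, map_zero]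
  have hsne : Polynomial.aeval x (φ s) ≠ 0 := by
    rw [hcomp, Ne, map_eq_zero_iff _ (IsFractionRing.injective D L), Ideal.Quotient.eq_zero_iff_mem]
    exact hs'
  -- `ḡ` and `F̄ = X^p + ḡ`
  set gK : K := algebraMap B K (Ideal.Quotient.mk 𝔮 g) with hgK
  have hφF : φ (X ^ p + C g) = X ^ p + C gK := by
    change Polynomial.map _ (X ^ p + C g) = _
    rw [Polynomial.map_add, Polynomial.map_pow, Polynomial.map_X, Polynomial.map_C]
    rfl
  -- `x̄` is integral over `K` (root of the monic `F̄`); `h = minpoly`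
  have hFx : Polynomial.aeval x (X ^ p + C gK : K[X]) = 0 := by
    rw [← hφF]; exact hzero _ hF
  have hint : IsIntegral K x := ⟨X ^ p + C gK, monic_X_pow_add_C gK hp.ne_zero, by
    rw [← Polynomial.aeval_def]; exact hFx⟩
  set h : K[X] := minpoly K x with hh
  have hprime : Prime h := minpoly.prime hint
  have hdvdF : h ∣ X ^ p + C gK := minpoly.dvd K x hFx
  have hndvd : ¬ h ∣ φ s := by
    intro hd
    apply hsne
    obtain ⟨r, hr⟩ := hd
    rw [hr, map_mul, hh, minpoly.aeval, zero_mul]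
  -- Step 2: `h² ∣ F̄`
  have hmap : Ideal.map φ 𝔭 ≤ Ideal.span {h} := by
    rw [Ideal.map_le_iff_le_comap]
    intro f hf
    rw [Ideal.mem_comap, Ideal.mem_span_singleton]
    exact minpoly.dvd K x (hzero f hf)
  have hsq : h ^ 2 ∣ φ s * (X ^ p + C gK) := by
    rw [← hφF, ← map_mul, ← Ideal.mem_span_singleton, ← Ideal.span_singleton_pow]
    have : φ (s * (X ^ p + C g)) ∈ Ideal.map φ (𝔭 ^ 2) := Ideal.mem_map_of_mem φ hsF
    rw [Ideal.map_pow] at this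
    exact Ideal.pow_right_mono hmap 2 this
  have hsq' : h ^ 2 ∣ X ^ p + C gK := hprime.pow_dvd_of_dvd_mul_left 2 hndvd hsq
  -- characteristic `p` on `K` and `K[X]`
  haveI : CharP K p := by
    refine (CharP.charP_iff_prime_eq_zero hp).mpr ?_
    rw [← map_natCast (algebraMap B K), ← map_natCast (Ideal.Quotient.mk 𝔮), CharP.cast_eq_zero A p,
      map_zero, map_zero]
  -- Step 3: Kummer dichotomy
  by_cases hc : ∃ c : K, c ^ p = -gK
  · obtain ⟨c, hcp⟩ := hc
    have hfac : (X ^ p + C gK : K[X]) = (X - C c) ^ p := by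
      rw [sub_pow_char, ← C_pow, hcp, C_neg, sub_neg_eq_add]
    have hdvd1 : h ∣ X - C c := by
      rw [hfac] at hdvdF
      exact hprime.dvd_of_dvd_pow hdvdF
    have hxc : x = algebraMap K L c := by
      obtain ⟨r, hr⟩ := hdvd1
      have : Polynomial.aeval x (X - C c : K[X]) = 0 := by
        rw [hr, map_mul, hh, minpoly.aeval, zero_mul]
      rw [map_sub, Polynomial.aeval_X, Polynomial.aeval_C, sub_eq_zero] at this
      exact this
    -- write `c = ā / b̄`
    obtain ⟨a', b', hb', hab⟩ := IsFractionRing.div_surjective (A := B) c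
    obtain ⟨a, rfl⟩ := Ideal.Quotient.mk_surjective a'
    obtain ⟨b, rfl⟩ := Ideal.Quotient.mk_surjective b'
    have hb0 : Ideal.Quotient.mk 𝔮 b ≠ 0 := nonZeroDivisors.ne_zero hb'
    have hbK : algebraMap B K (Ideal.Quotient.mk 𝔮 b) ≠ 0 := by
      rw [Ne, map_eq_zero_iff _ (IsFractionRing.injective B K)]
      exact hb0
    refine ⟨a, b, ?_, ?_⟩
    · -- `C b ∉ 𝔭` since `b ∉ 𝔮`
      intro hCb
      apply hb0
      exact Ideal.Quotient.eq_zero_iff_mem.mpr (by simpa [h𝔮] using hCb)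
    · -- `C b * X - C a ∈ 𝔭`: its image in `L` vanishes
      rw [← Ideal.Quotient.eq_zero_iff_mem, ← map_eq_zero_iff _ (IsFractionRing.injective D L),
        map_sub, map_mul, map_sub, map_mul, hja, hja, ← hx, hxc, ← map_mul, ← map_sub, ← hab,
        mul_div_cancel₀ _ hbK, sub_self, map_zero]
  · -- `−ḡ` not a `p`-th power: `F̄` irreducible, `h ~ F̄`, `h² ∣ h`: contradiction
    push Not at hc
    have hirr : Irreducible (X ^ p + C gK : K[X]) := by
      have e : (X ^ p - C (-gK) : K[X]) = X ^ p + C gK := by rw [map_neg, sub_neg_eq_add]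
      rw [← e]
      exact (X_pow_sub_C_irreducible_iff_of_prime hp).mpr hc
    have hass : Associated h (X ^ p + C gK) := (minpoly.irreducible hint).associated_of_dvd hirr hdvdF
    have h1 : h * h ∣ h * 1 := by
      rw [mul_one, ← pow_two]
      exact hsq'.trans hass.symm.dvd
    rw [mul_dvd_mul_iff_left (minpoly.ne_zero hint)] at h1
    exact absurd (isUnit_of_dvd_one h1) hprime.not_unit

end Summit.ResolutionOfSingularities.ResolutionOfSingularities.Theorems.EquisingularLift.PlanarShadow

end
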